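import Literature.MathematicalPhysics.QuantumFieldTheory.Balaban1983to89.B16Improved189ArbitraryRegion
import Literature.MathematicalPhysics.QuantumFieldTheory.Balaban1983to89.B16Cor3CurlyGas

/-!
# `Balaban1983to89.B16Cor3FactorLeavesOfBudget` — [Balaban1989LargeFieldII] p. 387 ll. 21–29 read into the Cor.-3
chain: the two FACTOR LEAVES `hZ` ∕ `hY` of the chain's torus END theorem
`B16Cor3CurlyGas.uvIneq_of_repr172_torus_of_ineq249_of_gas` SUPPLIED, component by component, from the (1.79)-factor
forms and the (1.80)-budget data of `Step.Budget` — (1.89) proper + condition (i) for the domains `Y_i` of (1.71)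
(horizon `K = 0`), (1.80) with `K ≥ 1` for the components of the new region `Z_k` — with NO trade and NO geometric
hypothesis, by the sibling `B16Improved189ArbitraryRegion` and (1.73) iterated

T. Bałaban, *Large field renormalization. II. Localization, exponentiation, and bounds for the 𝐑 operation*, Commun.
Math. Phys. **122** (1989) 355–392, doi:10.1007/bf01238433 [Balaban1989LargeFieldII] (cell paper B16 = [V]; PDF held
`paper:balaban1989-cmp122-large-field-ii`, journal page = PDF page + 354).  [III] = [Balaban1988Convergent], Commun. Math.
Phys. **119** (1988) 243–285, Cor. 3 (2.50) p. 264.  [IV] = [Balaban1989LargeFieldI] p. 177 (condition (i)).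

statement-level bookkeeping of a published proof with citation tags; proofs kernel-checked; nothing here is a claim
about the Yang–Mills mass gap.  Seat `pub-ymgap-dag-n13-d` (R134 seat (a), strategy s1′), YM-DAG node N13 [B16] Cor. 3
pp. 387 ∕ 391, `--supports stmt-QuantumFields-19674` (K1 `StabilityBAtRecordR11e`); second file of the seat.

CITATION HEADER (lean-in-tree rule 2026-08-18) ∕ WHAT IS PRINTED.  p. 387 [PDF 33] ll. 21–29: *"At first, the domain X
in the definition (1.71) satisfies the assumption of the statement with K = 0, therefore κ_k(X) ≧ 0, and we have the
fundamental inequality 𝐓′_k(X)1 ≦ exp(−2(1+β₀)⁻¹p₀(g_k)). (1.89) Next, we have noticed already that the inequality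
(1.79) holds for the 𝐓-operation connected with an arbitrary large field region. The inequality (1.80) holds quite
generally for such regions, hence also an improved bound (1.89), with the additional term −κ₁d_k(X) in the exponential.
This implies the inequality (2.50) [III], hence Corollary 3."*  p. 379 (1.72): *"(𝐑ρ_k)(V_k) = Σ_{Z_k} Σ_{{Y_1,…,Y_m}}
χ_k(⋯) · (Σ_{{Ω^c_j,Z_j}} 𝐓″_k(Z_k)) exp A′_k ⋯ Π_{i=1}^m ⋯ 𝐓′_k(Y_i) · {⋯}"*; p. 380 (1.73); p. 384 (the factor
`exp(−κ_j(Z) − 2p₀(g_{j(Z)}))` and (1.80)); [III] (2.19) p. 258 *"𝐓_k(Z_k) = Π_{i=1}^{n} 𝐓_k(X_i)"*.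

WHY THIS FILE.  The torus END theorem of the Cor.-3 chain (`B16Cor3CurlyGas.uvIneq_of_repr172_torus_of_ineq249_of_gas`, read at
the objects of record by `B16NodeKnitRecord9Cor3` ∕ `B16NodeKnitRecord10`) takes the two FACTOR LEAVES
`hZ : (Σ𝐓″_k(Z_k))1 ≤ Π_{X∈Z_k} e^{−c₀−κ₁d_k(X)}` and `hY : (Π_i𝐓_k(Y_i))1 ≤ Π_i e^{−c₁−κ₁d_k(Y_i)}` as hypotheses; module 15
lists them among «what remains a binder».  Their printed source is the sentence above: per component, the (1.79)-factor
form regrouped as `exp(−κ_k(X) − 2p₀(g_{j(X)}))` (p. 384) and the inductive statement (1.80); the entropy term `−κ₁d_k(X)`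
comes from condition (i) for the `Y_i` (horizon `K = 0` at scale `k`; `B16Improved189FullBudget.hgeo_of_condI`) and from the
`n = k+1` cost of (1.80) for the components of `Z_k` (horizon `K ≥ 1`; `B16Improved189ArbitraryRegion.improved189_arbitrary_torus`,
first file of this seat).  This file performs that supply BY NAME on the chain's own carrier `TreeLengthTorus.tsys n N` and
re-issues the END theorem with `hZ`, `hY` REPLACED by per-component `Step.Budget` data — so that, for the (UV) half of N13,
the factor leaves are no longer binders of their own: what remains there is the (1.79)-factor form per component (the
Gaussian small factors of [15]∕[16], `B16Ineq179`) and the (1.80)-history (`B16Lem384Induction.invariant_all_ofIndex`),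
i.e. exactly the objects of the typed auxiliary induction.

WHAT THIS FILE PROVES (kernel-checked, zero `sorry`, theorems only; axioms standard; BY NAME: `B16Cor3Ops.PosOp.{pi,
apply_le_of_le, one_nonneg}`, `B16Improved189.improved189_of_halved_budget`, `B16Improved189FullBudget.hgeo_of_condI`,
`B16Improved189ArbitraryRegion.{improved189_arbitrary_torus, torus_dj_le_treeLen_of_lift}`,
`B16Ineq197ClassOne.{fineCubes_nonempty_iff, faceConnected_fineCubes}`, `B16Cor3CurlyGas.uvIneq_of_repr172_torus_of_ineq249_of_gas`):
§1 (1.73) ITERATED FOR THE MEMBERS OF A LIST: `pi_one_le_of_forall_mem`, `pi_one_le_prod_of_forall_mem` (the tree's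
   `PosOp.pi_one_le` ∕ `pi_one_le_prod` with the per-factor weight asked only of the factors that OCCUR — the components of
   one term of (1.72), not of every domain of the catalogue).
§2 THE `K = 0` SUPPLIER ON THE TORUS: **`weight_horizon0_torus`** — for a domain `Y` of (1.71) whose M-cube family is the
   projection of `fineCubes R SY`, `SY` a non-empty face-connected family of MR_k-cube indices satisfying condition (i) with
   size `Nsz` (print 100): (1.89) proper `𝐓 ≤ e^{−2ap}` and the located clause `κ₁(Nsz·R)^d ≤ ap` give `𝐓 ≤ exp(−ap −
   κ₁·dj Y)` (half budget, `B16Improved189.improved189_of_halved_budget` ∘ `hgeo_of_condI`, projection never lengthens).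
§3 THE TWO LEAVES: **`hY_of_condI_torus`** (`hY` of the END theorem from §2 per `Y ∈ Ys t` and the composite structure
   `Π_i𝐓_k(Y_i) = PosOp.pi`), **`hZ_of_budget_torus`** (`hZ` from the factor form `𝐓 ≤ exp(−κ − P)`, (1.80)
   `Step.Budget.Controls b k K κ s` with `K ≥ 1` and `s_{k+1} = d′_{k+1}(S(X))`, `2ap ≤ P`, the dictionary `R_k·q = L·R_{k+1}`
   and the located clauses `hslope` ∕ `hdef`, per component `X ∈ Z_k` of every term, and the composite structure
   `(Σ𝐓″_k(Z_k)) = PosOp.pi` over the components, [III] (2.19)); both with the SAME constant `c₀ = c₁ = ap`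
   (`a = (1+β₀)⁻¹`, `p = p₀(g_k)` in the application).
§4 **`uvIneq_of_repr172_torus_of_budget_of_gas`** — THE END THEOREM OF THE CHAIN WITH THE FACTOR LEAVES SUPPLIED: verbatim
   `B16Cor3CurlyGas.uvIneq_of_repr172_torus_of_ineq249_of_gas` (dimension 4, `tsys 4 N`) with `hZ`, `hY` replaced by the
   per-component data of §3 and `c := (ap, ap)`; conclusion `B16.UVIneq` at every configuration with the chain's explicit
   `E₋`, `E₊` (entropy term `M⁻⁴·K₀(64,8)·2e^{−ap}`).
§5 (v1.1, append-only) THE WILSON READING: `hw_of_budget_torus` (the per-component weight `𝐓_X[B_X] ≤ exp(−ap − κ₁·dj X)` of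
   `B16Cor3Wilson` ∕ `B16Cor3Torus` from the same budget data, factor form stated for the weight function `V ↦ 𝐓_X[B_X](V)`),
   **`uvIneq_of_repr172_wilson_torus_of_budget`** (`B16Cor3Torus.uvIneq_of_repr172_wilson_torus` with `hw`, `hY` supplied).
HONEST SCOPE.  (a) By-name junction; count-neutral; NOT a discharge of N13.  (b) The per-component INPUTS are hypotheses
exactly as print states them: the (1.79)-factor form `𝐓_X 1 ≤ exp(−κ_k(X) − 2p₀(g_{j(X)}))` (p. 384; its Gaussian small
factors come from [15] Thm 1 and (71) [16] — cross-paper, `B16Ineq179` bookkeeping), (1.80) for the component (the typed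
auxiliary induction `B16Lem384Induction`), (1.89) proper for the `Y_i` (`Step.FundIneq189`-shape), the lifts of the torus
components to face-connected ℤᵈ index families (the cell's standing index-model READING, `B16SProfile`), condition (i)
for the `Y_i` at scale `k` ([IV] p. 177 — the `Y_i` are renormalized at this step), and the located constant clauses
(«for p₀ large and γ small enough», p. 387; «g_k small», p. 389).  (c) Which reading of `𝐓″_k` makes `hZ` the printed
mechanism (operation applied to `1`, or weighing its own Boltzmann factor — cell DIVERGENCE D-pv06.5, `B16Cor3Wilson`) is
untouched: the supply is for the END theorem's `hZ` as typed; the Wilson form's `hw` has the same per-component shape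
(`B16Improved189ArbitraryRegion` header).  (d) One finite four-torus programme at fixed `ε`, Bałaban AS PRINTED; nothing
continuum ∕ ℝ⁴ ∕ OS ∕ mass gap ∕ Clay.
-/

noncomputable section

namespace Literature.MathematicalPhysics.QuantumFieldTheory.Balaban1983to89.B16Cor3FactorLeavesOfBudget

open Literature.MathematicalPhysics.QuantumFieldTheory.Balaban1983to89
open Literature.MathematicalPhysics.QuantumFieldTheory.Balaban1983to89.B13ScaleTransfer (Pt FaceConnected)
open Literature.MathematicalPhysics.QuantumFieldTheory.Balaban1983to89.TreeLength (treeLen treeLen_nonneg)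
open Literature.MathematicalPhysics.QuantumFieldTheory.Balaban1983to89.B16SProfile (Sop)
open Literature.MathematicalPhysics.QuantumFieldTheory.Balaban1983to89.B13Factor210Literal (fineCubes)
open Literature.MathematicalPhysics.QuantumFieldTheory.Balaban1983to89.B16Ineq197ClassOne
  (fineCubes_nonempty_iff faceConnected_fineCubes)
open Literature.MathematicalPhysics.QuantumFieldTheory.Balaban1983to89.B16StoppingRule (CondI)
open Literature.MathematicalPhysics.QuantumFieldTheory.Balaban1983to89.B16Improved189FullBudget (hgeo_of_condI)
open Literature.MathematicalPhysics.QuantumFieldTheory.Balaban1983to89.B16Improved189ArbitraryRegion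
  (improved189_arbitrary_torus torus_dj_le_treeLen_of_lift)
open Literature.MathematicalPhysics.QuantumFieldTheory.Balaban1983to89.TreeLengthTorus (tsys proj)
open Literature.MathematicalPhysics.QuantumFieldTheory.Balaban1983to89.B16Cor3Ops (PosOp Repr172)
open Literature.MathematicalPhysics.QuantumFieldTheory.Balaban1983to89.B14Thm2 (Ineq249)
open Literature.MathematicalPhysics.QuantumFieldTheory.Balaban1983to89.B13FamilySum (Ineq126 VolBound)
open Literature.MathematicalPhysics.QuantumFieldTheory.Balaban1983to89.B16Eq190Resummation (bracket mayerTerm F191 polys190 LocalOps DepOn)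

/-! ## §1. (1.73) iterated, the weights asked only of the factors that occur -/

/-- **(1.73) ITERATED OVER A LIST, MEMBERWISE**: if every operation OCCURRING in the list `l` has a uniform weight
`T_d 1 ≤ w_d`, then `(T_{d₁}∘⋯∘T_{d_n})1 ≤ Π_i w_{d_i}` — the tree's `PosOp.pi_one_le` with the hypothesis restricted to
the members of `l`. [cite: Balaban1989LargeFieldII, (1.73) p.380] -/
theorem pi_one_le_of_forall_mem {C δ : Type*} (ops : δ → PosOp C) (w : δ → ℝ) :
    ∀ (l : List δ), (∀ d ∈ l, ∀ x, (ops d).T 1 x ≤ w d) → ∀ x : C, (PosOp.pi ops l).T 1 x ≤ (l.map w).prod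
  | [], _, x => by
      show (1 : C → ℝ) x ≤ (([] : List δ).map w).prod
      simp
  | d :: l, hw, x => by
      have hwd : ∀ y, (ops d).T 1 y ≤ w d := hw d List.mem_cons_self
      have hwl : ∀ d' ∈ l, ∀ y, (ops d').T 1 y ≤ w d' := fun d' hd' => hw d' (List.mem_cons_of_mem d hd')
      have hprod : 0 ≤ (l.map w).prod :=
        List.prod_nonneg fun r hr => by
          obtain ⟨d', hd', rfl⟩ := List.mem_map.mp hr
          exact ((ops d').one_nonneg x).trans (hwl d' hd' x)
      show (ops d).T ((PosOp.pi ops l).T 1) x ≤ ((d :: l).map w).prod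
      rw [List.map_cons, List.prod_cons]
      calc (ops d).T ((PosOp.pi ops l).T 1) x ≤ (l.map w).prod * (ops d).T 1 x :=
            (ops d).apply_le_of_le (fun y => pi_one_le_of_forall_mem ops w l hwl y) x
        _ ≤ (l.map w).prod * w d := mul_le_mul_of_nonneg_left (hwd x) hprod
        _ = w d * (l.map w).prod := mul_comm _ _

/-- The same with the product over the finite family enumerated (nodup) by `l`. [cite: Balaban1989LargeFieldII, (1.73) p.380] -/
theorem pi_one_le_prod_of_forall_mem {C δ : Type*} [DecidableEq δ] (ops : δ → PosOp C) (w : δ → ℝ) {l : List δ}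
    (hl : l.Nodup) (hw : ∀ d ∈ l, ∀ x, (ops d).T 1 x ≤ w d) (x : C) :
    (PosOp.pi ops l).T 1 x ≤ ∏ d ∈ l.toFinset, w d := by
  rw [List.prod_toFinset w hl]
  exact pi_one_le_of_forall_mem ops w l hw x

/-! ## §2. The `K = 0` supplier on the torus: (1.89) proper + condition (i) on the lift -/

variable {n : ℕ}

/-- **THE IMPROVED (1.89) FOR A DOMAIN OF (1.71) ON THE TORUS CATALOGUE** (horizon `K = 0`; p. 387 ll. 21–24 with the
additional term): a torus domain `Y` whose M-cube family is the projection of `fineCubes R SY`, `SY` a non-empty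
face-connected family of MR_k-cube indices satisfying condition (i) with size `Nsz` ([IV] p. 177; print `Nsz = 100`);
(1.89) proper `𝐓 ≤ e^{−2ap}` (`hT`; `a = (1+β₀)⁻¹`, `p = p₀(g_k)`) and the located clause `κ₁(Nsz·R)^d ≤ ap` (p. 389-type
`g_k`-smallness, cf. `B16Improved189.size_trade_of_exponents`) give `𝐓 ≤ exp(−ap − κ₁·dj Y)` — half budget
(`B16Improved189.improved189_of_halved_budget`), `d_k(Y) ≤ (Nsz·R)^d` on the lift (`hgeo_of_condI`), projection never
lengthens. [cite: Balaban1989LargeFieldII, (1.89) p.387 ll.21–29; Balaban1989LargeFieldI, p.177 (condition (i))] -/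
theorem weight_horizon0_torus {V : Type*} (T1X : V → ℝ) (a p κ₁ : ℝ) {R Nsz : ℕ} (hR : 0 < R)
    {SY : Finset (Pt n)} (hne : SY.Nonempty) (hfc : FaceConnected SY) (hI : CondI Nsz SY)
    {N : ℕ} [NeZero N] (Y : (tsys n N).Dom) (hlift : Y.1 = (fineCubes R SY).image (proj N))
    (hT : ∀ v, T1X v ≤ Real.exp (-(2 * a * p))) (hκ₁ : 0 ≤ κ₁)
    (hclause : κ₁ * (((Nsz : ℝ) * R) ^ n) ≤ a * p) :
    ∀ v, T1X v ≤ Real.exp (-(a * p) - κ₁ * (tsys n N).dj Y) := by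
  intro v
  have hgeo := hgeo_of_condI hR hne hfc hI
  have htrade : κ₁ * treeLen (fineCubes R SY) ≤ a * p := (mul_le_mul_of_nonneg_left hgeo hκ₁).trans hclause
  have h := B16Improved189.improved189_of_halved_budget T1X a p κ₁ _ hT htrade v
  have hdj : (tsys n N).dj Y ≤ treeLen (fineCubes R SY) :=
    torus_dj_le_treeLen_of_lift Y ((fineCubes_nonempty_iff hR).2 hne) (faceConnected_fineCubes hR hfc) hlift
  refine h.trans (Real.exp_le_exp.mpr ?_)
  nlinarith [mul_le_mul_of_nonneg_left hdj hκ₁]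

/-! ## §3. The two factor leaves of the END theorem from per-component data -/

/-- **THE LEAF `hY` FROM (1.89) PROPER + CONDITION (i), PER DOMAIN `Y_i` OF EVERY TERM** of (1.72): the composite
`Π_i𝐓_k(Y_i)` of the term `t` is `PosOp.pi (TY t)` over a nodup enumeration `lY t` of `Ys t` (`hTYs`), and every `Y ∈ Ys t`
carries a lift `SY t Y` (non-empty, face-connected, condition (i) with size `Nsz`, projecting onto `Y`) and (1.89) proper
for its operation; with the located clause `κ₁(Nsz·R)^d ≤ ap`: `(Π_i𝐓_k(Y_i))1 ≤ Π_{Y∈Ys t} exp(−ap − κ₁·dj Y)`.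
[cite: Balaban1989LargeFieldII, (1.72) p.379, (1.73) p.380, (1.89) p.387; Balaban1989LargeFieldI, p.177 (condition (i))] -/
theorem hY_of_condI_torus {Cfg : Type*} {N : ℕ} [NeZero N] (Rp : Repr172 Cfg (tsys n N).Dom)
    (TY : Rp.Adm → (tsys n N).Dom → PosOp Cfg) (lY : Rp.Adm → List (tsys n N).Dom)
    (hndY : ∀ t, (lY t).Nodup) (hsetY : ∀ t, (lY t).toFinset = Rp.Ys t)
    (hTYs : ∀ t F V, (Rp.TYs t).T F V = (PosOp.pi (TY t) (lY t)).T F V)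
    (a p κ₁ : ℝ) {R Nsz : ℕ} (hR : 0 < R) (hκ₁ : 0 ≤ κ₁) (hclause : κ₁ * (((Nsz : ℝ) * R) ^ n) ≤ a * p)
    (SY : Rp.Adm → (tsys n N).Dom → Finset (Pt n))
    (hdata : ∀ t, ∀ Y ∈ Rp.Ys t, (SY t Y).Nonempty ∧ FaceConnected (SY t Y) ∧ CondI Nsz (SY t Y) ∧
      Y.1 = (fineCubes R (SY t Y)).image (proj N) ∧ ∀ V, (TY t Y).T 1 V ≤ Real.exp (-(2 * a * p))) :
    ∀ t V, (Rp.TYs t).T 1 V ≤ ∏ Y ∈ Rp.Ys t, Real.exp (-(a * p) - κ₁ * (tsys n N).dj Y) := by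
  intro t V
  rw [hTYs t, ← hsetY t]
  refine pi_one_le_prod_of_forall_mem (TY t) (fun Y => Real.exp (-(a * p) - κ₁ * (tsys n N).dj Y)) (hndY t) ?_ V
  intro Y hY
  have hY' : Y ∈ Rp.Ys t := by rw [← hsetY t]; exact List.mem_toFinset.mpr hY
  obtain ⟨hne, hfc, hI, hlift, hT⟩ := hdata t Y hY'
  exact weight_horizon0_torus (fun V => (TY t Y).T 1 V) a p κ₁ hR hne hfc hI Y hlift hT hκ₁ hclause

/-- **THE LEAF `hZ` FROM THE (1.79)-FACTOR FORM + THE (1.80)-BUDGET, PER COMPONENT OF `Z_k` OF EVERY TERM** of (1.72)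
(p. 387 ll. 25–29 «for the 𝐓-operation connected with an arbitrary large field region»): the operation `(Σ𝐓″_k(Z_k))` of the
term `t` is the composite `PosOp.pi (T t)` over a nodup enumeration `l t` of the components `Zc t` ([III] (2.19), `hTZ`),
and every component `X ∈ Zc t` carries, in the index model at scale `k`: a lift `X₀ t X` (non-empty face-connected family
of MR_k-cube indices projecting onto `X`), a horizon `K t X ≥ 1`, a budget `κ t X` with the factor form
`𝐓 ≤ exp(−κ − P)` (p. 384) and (1.80) `Controls b k K κ s` for a non-negative profile `s t X` whose entry at `k+1` is
`d′_{k+1}(S(X)) = treeLen (Sop q (X₀ t X))`, and `2ap ≤ P t X` (half of `2p₀(g_{j(X)})`); with the dictionary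
`R_k·q = L·R_{k+1}`, `b.d = d` and the located clauses `hslope`, `hdef` of `B16Improved189.improved189_of_budget_general`:
`(Σ𝐓″_k(Z_k))1 ≤ Π_{X∈Zc t} exp(−ap − κ₁·dj X)` — `improved189_arbitrary_torus` per component, (1.73) iterated.
[cite: Balaban1989LargeFieldII, p.387 ll.25–29, (1.80) p.384, (1.72)–(1.73) pp.379–380; Balaban1988Convergent, (2.19) p.258] -/
theorem hZ_of_budget_torus {Cfg : Type*} {N : ℕ} [NeZero N] (Rp : Repr172 Cfg (tsys n N).Dom)
    (T : Rp.Adm → (tsys n N).Dom → PosOp Cfg) (l : Rp.Adm → List (tsys n N).Dom)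
    (hnd : ∀ t, (l t).Nodup) (hset : ∀ t, (l t).toFinset = Rp.Zc t)
    (hTZ : ∀ t F V, (Rp.TZ t).T F V = (PosOp.pi (T t) (l t)).T F V)
    (b : Step.Budget.Consts) (k : ℕ) (a p κ₁ L : ℝ) {R q : ℕ} (hR : 0 < R) (hq : 0 < q)
    (hC : 0 ≤ b.C) (hM : 0 ≤ b.M) (hRm : ∀ m, 0 ≤ b.R m) (hdim : b.d = n)
    (hRq : ((R * q : ℕ) : ℝ) = L * b.R (k + 1)) (hκ₁ : 0 ≤ κ₁) (hL : 0 ≤ L)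
    (hslope : κ₁ * (4 * 2 ^ n) * L ^ b.d ≤ b.C * b.M ^ b.d * b.R (k + 1))
    (hdef : κ₁ * ((4 * 2 ^ n) * (L * b.R (k + 1)) ^ b.d) ≤ a * p)
    (X₀ : Rp.Adm → (tsys n N).Dom → Finset (Pt n)) (K : Rp.Adm → (tsys n N).Dom → ℕ)
    (κ P : Rp.Adm → (tsys n N).Dom → ℝ) (s : Rp.Adm → (tsys n N).Dom → ℕ → ℝ)
    (hdata : ∀ t, ∀ X ∈ Rp.Zc t, (X₀ t X).Nonempty ∧ FaceConnected (X₀ t X) ∧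
      X.1 = (fineCubes R (X₀ t X)).image (proj N) ∧ 1 ≤ K t X ∧
      (∀ V, (T t X).T 1 V ≤ Real.exp (-(κ t X) - P t X)) ∧ Step.Budget.Controls b k (K t X) (κ t X) (s t X) ∧
      (∀ m, 0 ≤ s t X m) ∧ s t X (k + 1) = treeLen (Sop q (X₀ t X)) ∧ 2 * a * p ≤ P t X) :
    ∀ t V, (Rp.TZ t).T 1 V ≤ ∏ X ∈ Rp.Zc t, Real.exp (-(a * p) - κ₁ * (tsys n N).dj X) := by
  intro t V
  rw [hTZ t, ← hset t]
  refine pi_one_le_prod_of_forall_mem (T t) (fun X => Real.exp (-(a * p) - κ₁ * (tsys n N).dj X)) (hnd t) ?_ V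
  intro X hX
  have hX' : X ∈ Rp.Zc t := by rw [← hset t]; exact List.mem_toFinset.mpr hX
  obtain ⟨hne, hfc, hlift, hK, hT, hctl, hs, hsize, hP⟩ := hdata t X hX'
  exact improved189_arbitrary_torus (fun V => (T t X).T 1 V) b k (K t X) hK (κ t X) (P t X) a p κ₁ L (s t X) hR hq
    hne hfc X hlift hT hctl hC hM hRm hs hsize hdim hRq hκ₁ hL hslope hP hdef

/-! ## §4. The END theorem of the chain with the factor leaves supplied -/

/-- **(0.1) ∕ (2.50), ONE RUN, ONE STEP, ON THE TORUS — THE FACTOR LEAVES SUPPLIED FROM `Step.Budget` DATA**: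
`B16Cor3CurlyGas.uvIneq_of_repr172_torus_of_ineq249_of_gas` (dimension 4, carrier `tsys 4 N`) with its hypotheses `hZ`, `hY`
REPLACED by the per-component data of `hZ_of_budget_torus` (components of `Z_k`: lifts, horizons `K ≥ 1`, budgets with
the (1.79)-factor form, (1.80), profiles, `2ap ≤ P`; dictionary `R_k·q = L·R_{k+1}`; clauses `hslope`, `hdef`) and of
`hY_of_condI_torus` (domains `Y_i`: lifts satisfying condition (i) with size `Nsz`, (1.89) proper; clause `κ₁(Nsz·R_k)^4 ≤
ap`), both constants `c₀ = c₁ = ap`; every other input ((1.72) datum, χ-dictionary, the (1.90) gas, the cube count, (2.49)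
with the volume majorant and the log-term bounds, the sign of `A`) and the conclusion VERBATIM, the entropy term reading
`M⁻⁴·K₀(64,8)·Σ_{i<2} e^{−ap}`.  CONDITIONAL on every input; nothing of Bałaban's asserted. [cite: Balaban1989LargeFieldII, (0.1) p.356, p.387 ll.21–29, (1.80) p.384; Balaban1988Convergent, Cor. 3 (2.49)–(2.50) p.264] -/
theorem uvIneq_of_repr172_torus_of_budget_of_gas (D : B16.RunData) (k : ℕ) (N : ℕ) [NeZero N]
    (Rp : Repr172 (D.Cfg k) (tsys 4 N).Dom)
    {M : ℝ} (hM0 : M ≠ 0) (hnum : (D.numSites k : ℝ) = (M * N) ^ 4)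
    {κ₁ : ℝ} (hκ : B12TreeDecay.kappa₀ (4 * 2 ^ 4) (2 * 4) ≤ κ₁) (hκ₁ : 0 ≤ κ₁) (a p : ℝ)
    (hH : Rp.Holds (D.ρ k))
    (hχ01 : ∀ t V, 0 ≤ Rp.χ t V ∧ Rp.χ t V ≤ 1)
    (h0χ : ∀ V, Rp.χ Rp.allSmall V = D.χ k V)
    -- the components of `Z_k`: composite structure and per-component (1.79)/(1.80) data, replacing `hZ`
    (T : Rp.Adm → (tsys 4 N).Dom → PosOp (D.Cfg k)) (l : Rp.Adm → List (tsys 4 N).Dom)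
    (hnd : ∀ t, (l t).Nodup) (hset : ∀ t, (l t).toFinset = Rp.Zc t)
    (hTZ : ∀ t F V, (Rp.TZ t).T F V = (PosOp.pi (T t) (l t)).T F V)
    (b : Step.Budget.Consts) (L : ℝ) {R q : ℕ} (hR : 0 < R) (hq : 0 < q)
    (hC : 0 ≤ b.C) (hbM : 0 ≤ b.M) (hRm : ∀ m, 0 ≤ b.R m) (hdim : b.d = 4)
    (hRq : ((R * q : ℕ) : ℝ) = L * b.R (k + 1)) (hL : 0 ≤ L)
    (hslope : κ₁ * (4 * 2 ^ 4) * L ^ b.d ≤ b.C * b.M ^ b.d * b.R (k + 1))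
    (hdef : κ₁ * ((4 * 2 ^ 4) * (L * b.R (k + 1)) ^ b.d) ≤ a * p)
    (X₀ : Rp.Adm → (tsys 4 N).Dom → Finset (Pt 4)) (K : Rp.Adm → (tsys 4 N).Dom → ℕ)
    (κ P : Rp.Adm → (tsys 4 N).Dom → ℝ) (s : Rp.Adm → (tsys 4 N).Dom → ℕ → ℝ)
    (hdataZ : ∀ t, ∀ X ∈ Rp.Zc t, (X₀ t X).Nonempty ∧ FaceConnected (X₀ t X) ∧
      X.1 = (fineCubes R (X₀ t X)).image (proj N) ∧ 1 ≤ K t X ∧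
      (∀ V, (T t X).T 1 V ≤ Real.exp (-(κ t X) - P t X)) ∧ Step.Budget.Controls b k (K t X) (κ t X) (s t X) ∧
      (∀ m, 0 ≤ s t X m) ∧ s t X (k + 1) = treeLen (Sop q (X₀ t X)) ∧ 2 * a * p ≤ P t X)
    -- the domains `Y_i`: composite structure and per-domain (1.89) + condition (i) data, replacing `hY`
    (TY : Rp.Adm → (tsys 4 N).Dom → PosOp (D.Cfg k)) (lY : Rp.Adm → List (tsys 4 N).Dom)
    (hndY : ∀ t, (lY t).Nodup) (hsetY : ∀ t, (lY t).toFinset = Rp.Ys t)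
    (hTYs : ∀ t F V, (Rp.TYs t).T F V = (PosOp.pi (TY t) (lY t)).T F V)
    {Nsz : ℕ} (hclause : κ₁ * (((Nsz : ℝ) * R) ^ 4) ≤ a * p)
    (SY : Rp.Adm → (tsys 4 N).Dom → Finset (Pt 4))
    (hdataY : ∀ t, ∀ Y ∈ Rp.Ys t, (SY t Y).Nonempty ∧ FaceConnected (SY t Y) ∧ CondI Nsz (SY t Y) ∧
      Y.1 = (fineCubes R (SY t Y)).image (proj N) ∧ ∀ V, (TY t Y).T 1 V ≤ Real.exp (-(2 * a * p)))
    -- the (1.90) gas of every admissible term (verbatim)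
    {LF DomY Cube Var Sv : Type*} [Fintype LF] [Fintype DomY] [Fintype Cube] [DecidableEq LF] [DecidableEq DomY]
    [DecidableEq Cube] {adjC : Cube → Cube → Prop} [DecidableRel adjC]
    (hrefl : ∀ c, adjC c c) (hsymm : ∀ c c', adjC c c' → adjC c' c)
    {locX : LF → Finset Cube} {locY : DomY → Finset Cube} {site : Var → Cube} (Yfix : Rp.Adm → Finset Cube)
    (houtX : ∀ t j, (locX j \ Yfix t).Nonempty) (houtY : ∀ t Y, (locY Y \ Yfix t).Nonempty)
    (Op : Rp.Adm → Finset LF → ((Var → Sv) → ℂ) →+ ((Var → Sv) → ℂ))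
    (hOps : ∀ t, LocalOps adjC locX (Yfix t) site (Op t))
    (hOpReal : ∀ t (S : Finset LF) (f : (Var → Sv) → ℂ), (∀ ψ, (f ψ).im = 0) → ∀ φ, (Op t S f φ).im = 0)
    (Vt : Rp.Adm → DomY → (Var → Sv) → ℂ) (hV : ∀ t Y, DepOn (Yfix t) site (Vt t Y) (locY Y))
    (hVreal : ∀ t Y ψ, (Vt t Y ψ).im = 0) (cfg : D.Cfg k → (Var → Sv))
    {nbr : Cube → Finset Cube} (hnbr : ∀ c c', adjC c c' → c ∈ nbr c') {ν : ℝ} (hν : ∀ c, ((nbr c).card : ℝ) ≤ ν)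
    {d : Rp.Adm → Finset Cube → ℝ} {c₁ Rr κ₀ K₀ cv τ : ℝ} (hd : ∀ t X, 0 ≤ d t X) (hc₁ : 0 ≤ c₁) (hK₀ : 0 ≤ K₀)
    (hτ : 0 ≤ τ)
    (h197 : ∀ t V X, ‖F191 adjC locX locY (Yfix t) (mayerTerm (Op t) (Vt t) (cfg V)) X‖ ≤ c₁ * Real.exp (-(Rr * d t X)))
    (h126 : ∀ t, Ineq126 (polys190 adjC locX locY (Yfix t)) (fun X => X \ Yfix t) (d t) κ₀ K₀)
    (hvol : ∀ t, VolBound (polys190 adjC locX locY (Yfix t)) (fun X => X \ Yfix t) (d t) cv)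
    (hrate : κ₀ + τ * cv ≤ Rr) (hsmall : c₁ * Real.exp (τ * cv) * K₀ * ν ≤ τ)
    (hjunction : ∀ t V, Rp.curly t V = (bracket (Op t) (Vt t) (cfg V)).re)
    {πc : ℝ} (hQ : (Fintype.card Cube : ℝ) ≤ πc * (D.numSites k : ℝ))
    -- (2.49) for `A′` and its logarithmic terms (verbatim)
    (logT : D.Cfg k → ℝ) {CA cΓ cL cL' : ℝ} {Γ : ℕ → ℝ} (hCA : 0 ≤ CA)
    (hΓ : ∑ m ∈ Finset.Icc 1 k, Γ m ≤ cΓ * (D.numSites k : ℝ))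
    (h249 : ∀ V, Ineq249 (Rp.A' V) (1 / (D.flow.g k) ^ 2 * D.wilsonBG k V) (logT V) CA Γ k)
    (hlog : ∀ V, -(cL * (D.numSites k : ℝ)) ≤ logT V) (hlog' : ∀ V, logT V ≤ cL' * (D.numSites k : ℝ))
    (hA0 : ∀ V, 0 ≤ D.wilsonBG k V) :
    ∀ V : D.Cfg k, B16.UVIneq D k V (CA * cΓ + cL + πc * (c₁ * Real.exp (τ * cv) * K₀))
      (CA * cΓ + cL' + πc * (c₁ * Real.exp (τ * cv) * K₀) +
        M⁻¹ ^ 4 * B12TreeDecay.K₀ (4 * 2 ^ 4) (2 * 4) * ∑ _i : Fin 2, Real.exp (-(a * p))) :=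
  B16Cor3CurlyGas.uvIneq_of_repr172_torus_of_ineq249_of_gas D k N Rp hM0 hnum hκ (fun _ => a * p) hH hχ01 h0χ
    (hZ_of_budget_torus Rp T l hnd hset hTZ b k a p κ₁ L hR hq hC hbM hRm hdim hRq hκ₁ hL hslope hdef X₀ K κ P s
      hdataZ)
    (hY_of_condI_torus Rp TY lY hndY hsetY hTYs a p κ₁ hR hκ₁ hclause SY hdataY)
    hrefl hsymm Yfix houtX houtY Op hOps hOpReal Vt hV hVreal cfg hnbr hν hd hc₁ hK₀ hτ h197 h126 hvol hrate hsmall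
    hjunction hQ logT hCA hΓ h249 hlog hlog' hA0

/-! ## §5 (v1.1, append-only). The WILSON form (cell DIVERGENCE D-pv06.5, `B16Cor3Wilson` ∕ `B16Cor3Torus`): the
per-component weight `hw : 𝐓_X[B_X] ≤ exp(−c₀ − κ₁d_k(X))` from the same budget data, and the torus END theorem of that
reading with `hw`, `hY` supplied

In the Wilson reading the operation of a component of `Z_k` weighs its own Boltzmann factor `B_X` (the small factor comes
from the Wilson action inside `exp A′_k`, [III] p. 264, [V] p. 380); the (1.79)-factor form is then a bound on the WEIGHT
FUNCTION `V ↦ 𝐓_X[B_X](V)` (p. 384), and §4 of the sibling applies to it verbatim. -/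

/-- **THE WILSON-FORM LEAF `hw` FROM THE (1.79)-FACTOR FORM + THE (1.80)-BUDGET, PER COMPONENT OF `Z_k`**: as
`hZ_of_budget_torus`, with the factor form stated for the weight function `V ↦ 𝐓_X[B_X](V)` of each component
(`𝐓_X[B_X] ≤ exp(−κ_k(X) − P)`): `𝐓_X[B_X] ≤ exp(−ap − κ₁·dj X)` for every component `X ∈ Zc t` of every term — the
hypothesis `hw` of `B16Cor3Torus.uvIneq_of_repr172_wilson_torus` ∕ `…wilsonSplit_torus` with `c 0 = ap`.
[cite: Balaban1989LargeFieldII, p.387 ll.25–29, (1.80) p.384, p.380 after (1.73); Balaban1988Convergent, p.264 after (2.49)] -/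
theorem hw_of_budget_torus {Cfg : Type*} {N : ℕ} [NeZero N] (Rp : Repr172 Cfg (tsys n N).Dom)
    (T : Rp.Adm → (tsys n N).Dom → PosOp Cfg) (B : Rp.Adm → (tsys n N).Dom → Cfg → ℝ)
    (b : Step.Budget.Consts) (k : ℕ) (a p κ₁ L : ℝ) {R q : ℕ} (hR : 0 < R) (hq : 0 < q)
    (hC : 0 ≤ b.C) (hM : 0 ≤ b.M) (hRm : ∀ m, 0 ≤ b.R m) (hdim : b.d = n)
    (hRq : ((R * q : ℕ) : ℝ) = L * b.R (k + 1)) (hκ₁ : 0 ≤ κ₁) (hL : 0 ≤ L)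
    (hslope : κ₁ * (4 * 2 ^ n) * L ^ b.d ≤ b.C * b.M ^ b.d * b.R (k + 1))
    (hdef : κ₁ * ((4 * 2 ^ n) * (L * b.R (k + 1)) ^ b.d) ≤ a * p)
    (X₀ : Rp.Adm → (tsys n N).Dom → Finset (Pt n)) (K : Rp.Adm → (tsys n N).Dom → ℕ)
    (κ P : Rp.Adm → (tsys n N).Dom → ℝ) (s : Rp.Adm → (tsys n N).Dom → ℕ → ℝ)
    (hdata : ∀ t, ∀ X ∈ Rp.Zc t, (X₀ t X).Nonempty ∧ FaceConnected (X₀ t X) ∧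
      X.1 = (fineCubes R (X₀ t X)).image (proj N) ∧ 1 ≤ K t X ∧
      (∀ V, (T t X).T (B t X) V ≤ Real.exp (-(κ t X) - P t X)) ∧ Step.Budget.Controls b k (K t X) (κ t X) (s t X) ∧
      (∀ m, 0 ≤ s t X m) ∧ s t X (k + 1) = treeLen (Sop q (X₀ t X)) ∧ 2 * a * p ≤ P t X) :
    ∀ t, ∀ X ∈ Rp.Zc t, ∀ V, (T t X).T (B t X) V ≤ Real.exp (-(a * p) - κ₁ * (tsys n N).dj X) := by
  intro t X hX
  obtain ⟨hne, hfc, hlift, hK, hT, hctl, hs, hsize, hP⟩ := hdata t X hX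
  exact improved189_arbitrary_torus (fun V => (T t X).T (B t X) V) b k (K t X) hK (κ t X) (P t X) a p κ₁ L (s t X) hR hq
    hne hfc X hlift hT hctl hC hM hRm hs hsize hdim hRq hκ₁ hL hslope hP hdef

/-- **(0.1) ∕ (2.50), ONE RUN, ONE STEP, WILSON FORM ON THE TORUS — THE LEAVES `hw`, `hY` SUPPLIED FROM `Step.Budget` DATA**:
`B16Cor3Torus.uvIneq_of_repr172_wilson_torus` (gen 5's Wilson reading: component structure `hTZ`, pull-out law `hpull`,
Boltzmann factors `B`, split `hsplit : exp A′_k ≤ e^{E′N}·Π_X B_X`) with `hw` replaced by the per-component budget data of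
`hw_of_budget_torus` and `hY` by the condition-(i) data of `hY_of_condI_torus` (`c 0 = c 1 = ap`); every other input and
the conclusion (`E₋ = E₁ + ε`, `E₊ = E′ + ε′ + M⁻⁴·K₀(64,8)·Σ_{i<2} e^{−ap}`) verbatim.  CONDITIONAL on every input; nothing
of Bałaban's asserted. [cite: Balaban1989LargeFieldII, (0.1) p.356, p.380 after (1.73), p.387 ll.21–29; Balaban1988Convergent, Cor. 3 (2.50) p.264] -/
theorem uvIneq_of_repr172_wilson_torus_of_budget (D : B16.RunData) (k : ℕ) (N : ℕ) [NeZero N]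
    (Rp : Repr172 (D.Cfg k) (tsys 4 N).Dom)
    {M : ℝ} (hM0 : M ≠ 0) (hnum : (D.numSites k : ℝ) = (M * N) ^ 4)
    {κ₁ : ℝ} (hκ : B12TreeDecay.kappa₀ (4 * 2 ^ 4) (2 * 4) ≤ κ₁) (hκ₁ : 0 ≤ κ₁) (a p : ℝ)
    (Rre : D.Cfg k → ℝ) (E₁ ε ε' E' : ℝ)
    (hH : Rp.Holds (D.ρ k))
    (hχ01 : ∀ t V, 0 ≤ Rp.χ t V ∧ Rp.χ t V ≤ 1)
    (h0χ : ∀ V, Rp.χ Rp.allSmall V = D.χ k V)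
    (T : Rp.Adm → (tsys 4 N).Dom → PosOp (D.Cfg k)) (l : Rp.Adm → List (tsys 4 N).Dom)
    (hnd : ∀ t, (l t).Nodup) (hset : ∀ t, (l t).toFinset = Rp.Zc t)
    (hTZ : ∀ t F V, (Rp.TZ t).T F V = (PosOp.pi (T t) (l t)).T F V)
    (B : Rp.Adm → (tsys 4 N).Dom → D.Cfg k → ℝ)
    (hB : ∀ t, ∀ X ∈ Rp.Zc t, ∀ V, 0 ≤ B t X V)
    (hpull : ∀ t, ∀ X ∈ Rp.Zc t, ∀ X' ∈ Rp.Zc t, X ≠ X' → B16Cor3Wilson.Pull (T t X) (B t X'))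
    -- per-component budget data replacing `hw`
    (b : Step.Budget.Consts) (L : ℝ) {R q : ℕ} (hR : 0 < R) (hq : 0 < q)
    (hC : 0 ≤ b.C) (hbM : 0 ≤ b.M) (hRm : ∀ m, 0 ≤ b.R m) (hdim : b.d = 4)
    (hRq : ((R * q : ℕ) : ℝ) = L * b.R (k + 1)) (hL : 0 ≤ L)
    (hslope : κ₁ * (4 * 2 ^ 4) * L ^ b.d ≤ b.C * b.M ^ b.d * b.R (k + 1))
    (hdef : κ₁ * ((4 * 2 ^ 4) * (L * b.R (k + 1)) ^ b.d) ≤ a * p)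
    (X₀ : Rp.Adm → (tsys 4 N).Dom → Finset (Pt 4)) (K : Rp.Adm → (tsys 4 N).Dom → ℕ)
    (κ P : Rp.Adm → (tsys 4 N).Dom → ℝ) (s : Rp.Adm → (tsys 4 N).Dom → ℕ → ℝ)
    (hdataZ : ∀ t, ∀ X ∈ Rp.Zc t, (X₀ t X).Nonempty ∧ FaceConnected (X₀ t X) ∧
      X.1 = (fineCubes R (X₀ t X)).image (proj N) ∧ 1 ≤ K t X ∧
      (∀ V, (T t X).T (B t X) V ≤ Real.exp (-(κ t X) - P t X)) ∧ Step.Budget.Controls b k (K t X) (κ t X) (s t X) ∧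
      (∀ m, 0 ≤ s t X m) ∧ s t X (k + 1) = treeLen (Sop q (X₀ t X)) ∧ 2 * a * p ≤ P t X)
    (hsplit : ∀ t V, Real.exp (Rp.A' V) ≤ Real.exp (E' * (D.numSites k : ℝ)) * ∏ X ∈ Rp.Zc t, B t X V)
    -- per-domain (1.89) + condition (i) data replacing `hY`
    (TY : Rp.Adm → (tsys 4 N).Dom → PosOp (D.Cfg k)) (lY : Rp.Adm → List (tsys 4 N).Dom)
    (hndY : ∀ t, (lY t).Nodup) (hsetY : ∀ t, (lY t).toFinset = Rp.Ys t)
    (hTYs : ∀ t F V, (Rp.TYs t).T F V = (PosOp.pi (TY t) (lY t)).T F V)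
    {Nsz : ℕ} (hclause : κ₁ * (((Nsz : ℝ) * R) ^ 4) ≤ a * p)
    (SY : Rp.Adm → (tsys 4 N).Dom → Finset (Pt 4))
    (hdataY : ∀ t, ∀ Y ∈ Rp.Ys t, (SY t Y).Nonempty ∧ FaceConnected (SY t Y) ∧ CondI Nsz (SY t Y) ∧
      Y.1 = (fineCubes R (SY t Y)).image (proj N) ∧ ∀ V, (TY t Y).T 1 V ≤ Real.exp (-(2 * a * p)))
    (hcurly : ∀ t V, 0 ≤ Rp.curly t V ∧ Rp.curly t V ≤ Real.exp (ε' * (D.numSites k : ℝ)))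
    (h0c : ∀ V, Rp.curly Rp.allSmall V = Real.exp (Rre V))
    (hRre : ∀ V, |Rre V| ≤ ε * (D.numSites k : ℝ))
    (hA' : ∀ V, D.χ k V ≠ 0 →
      -(1 / (D.flow.g k) ^ 2 * D.wilsonBG k V) - E₁ * (D.numSites k : ℝ) ≤ Rp.A' V) :
    ∀ V : D.Cfg k, B16.UVIneq D k V (E₁ + ε)
      (E' + ε' + M⁻¹ ^ 4 * B12TreeDecay.K₀ (4 * 2 ^ 4) (2 * 4) * ∑ _i : Fin 2, Real.exp (-(a * p))) :=
  B16Cor3Torus.uvIneq_of_repr172_wilson_torus D k N Rp hM0 hnum hκ (fun _ => a * p) Rre E₁ ε ε' E' hH hχ01 h0χ T l hnd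
    hset hTZ B hB hpull
    (hw_of_budget_torus Rp T B b k a p κ₁ L hR hq hC hbM hRm hdim hRq hκ₁ hL hslope hdef X₀ K κ P s hdataZ)
    hsplit (hY_of_condI_torus Rp TY lY hndY hsetY hTYs a p κ₁ hR hκ₁ hclause SY hdataY) hcurly h0c hRre hA'

end Literature.MathematicalPhysics.QuantumFieldTheory.Balaban1983to89.B16Cor3FactorLeavesOfBudget

end
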